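import Mathlib
import HarnessLib
import Literature.Combinatorics.Additive.Pollard
import Literature.Combinatorics.Additive.GrynkiewiczPollardRep
import Literature.Combinatorics.Additive.GrynkiewiczPollardStepOne
import Literature.Combinatorics.Additive.PollardFourThirds

/-!
# Pollard's theorem in general abelian groups (Grynkiewicz–Wang 2026) — IV: the application to restricted sumsets

Topic: `Literature/Combinatorics/Additive`.  Fourth file of the port of D. J. Grynkiewicz, R. Wang,
*Pollard's theorem in general abelian groups*, arXiv:2601.17922 (2026): §3, **Theorem 3.2**.

For an abelian group `G`, `A, B ⊆ G` and a map `τ : A → G`, the restricted sumset is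
`A +^τ B = {a + b : a ∈ A, b ∈ B, b ≠ τ(a)}`.  Lev [Lev2000] proved `|A +^τ B| > |G| − √|G| − 1/2` when
`|A| + |B| ≥ |G| + 1` and `τ` is injective (Theorem 3.1 of the source, not formalised here).

**Theorem 3.2** (verbatim, p. 13): «Let `G` be a finite abelian group, let `A, B ⊆ G` be subsets with
`|A| + |B| ≥ |G| + 1`, and let `τ : A ↪ G` be an injective map.  Then
`|A +^τ B| ≥ |G| + (1 − 4√(3 min{|A|, |B|}))/3`.»

Proof as printed (pp. 13–14): with `M = min{|A|,|B|}`, for every integer `t ∈ [2, M]`,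
`|A +^τ B| ≥ |G| − (4/3)t − M/t + 5/3` — Case I (`Σ_{i≤t}|A+_iB| ≥ t|A|+t|B| − (4/3)t² + (2/3)t`): from
`t|A +^τ B| + |τ| ≥ Σ_{i≤t} |A +_i B|` (`NS_le_mul_card_restricted_add`); Case II: Theorem 1.8 gives
`A′, B′` with `ℓ ≤ t − 1` and `A′ +_t B′ = A′ + B′ = A +_t B`, `A + B = G` by pigeonhole, and counting the
missing sums through the pairs `(a, τ a)` gives `|A +^τ B| ≥ |G| − ℓ − (M − ℓ)/t ≥ |G| − t − (M+1)/t + 2`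
(`restricted_of_str`); then `t = ⌈√(3M)/2⌉`.  We prove the integer form
`3t|G| + 5t ≤ 3t|A +^τ B| + 4t² + 3M` for all `2 ≤ t ≤ M` (`key_ineq`) from the dichotomy
`GrynkiewiczWang.goal_all` (file III), and then the printed real bound (`grynkiewiczWang2026_thm_3_2`).
Rendering: `τ : G → G` injective on `A` (only its values on `A` matter); the restricted sumset is written
out as `((A ×ˢ B).filter (p ↦ p.2 ≠ τ p.1)).image (p ↦ p.1 + p.2)` (no new definition); `|τ|` of the source
is `#{a ∈ A : τ a ∈ B}`.

## References
* D. J. Grynkiewicz, R. Wang, arXiv:2601.17922 (2026), §3 Theorem 3.2 [cite: GrynkiewiczWang2026, Thm 3.2].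
* V. F. Lev, *Restricted set addition in groups II*, Electron. J. Combin. 7 (2000) R4 (Theorem 3.1 of the
  source; cited only).
-/

namespace Literature.Combinatorics.Additive

namespace GrynkiewiczWang

open Finset Pollard Grynkiewicz
open scoped Pointwise

variable {G : Type*} [AddCommGroup G] [DecidableEq G]

section Counting

variable {t : ℕ} {A B : Finset G} {τ : G → G}

/-- `t |A +^τ B| + |τ| ≥ Σ_{i≤t} |A +_i B|` («trivially», Case I of the source): an element of the restricted
sumset contributes at most `t`, any other element of `A + B` has all its representations of the form
`(a, τ a)`. [cite: GrynkiewiczWang2026, Thm 3.2] -/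
theorem NS_le_mul_card_restricted_add (t : ℕ) (A B : Finset G) (τ : G → G) :
    NS t A B ≤ t * (((A ×ˢ B).filter (fun p => p.2 ≠ τ p.1)).image (fun p => p.1 + p.2)).card +
      (A.filter (fun a => τ a ∈ B)).card := by
  set R := ((A ×ˢ B).filter (fun p => p.2 ≠ τ p.1)).image (fun p => p.1 + p.2) with hR
  set D := A.filter (fun a => τ a ∈ B) with hD
  unfold NS
  rw [← sum_filter_add_sum_filter_not (A + B) (fun w => w ∈ R)]
  have h1 : ∑ w ∈ (A + B).filter (fun w => w ∈ R), min t (rep A B w) ≤ t * R.card := by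
    calc ∑ w ∈ (A + B).filter (fun w => w ∈ R), min t (rep A B w)
        ≤ ∑ w ∈ (A + B).filter (fun w => w ∈ R), t := sum_le_sum fun w _ => min_le_left _ _
      _ = ((A + B).filter (fun w => w ∈ R)).card * t := by rw [sum_const, smul_eq_mul]
      _ ≤ R.card * t := Nat.mul_le_mul_right t (card_le_card fun w hw => (mem_filter.1 hw).2)
      _ = t * R.card := mul_comm _ _
  -- outside `R`, every representation of `w` is `(a, τ a)`: `rep A B w ≤ #{a ∈ D : a + τ a = w}`
  have h2 : ∑ w ∈ (A + B).filter (fun w => w ∉ R), min t (rep A B w) ≤ D.card := by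
    calc ∑ w ∈ (A + B).filter (fun w => w ∉ R), min t (rep A B w)
        ≤ ∑ w ∈ (A + B).filter (fun w => w ∉ R), (D.filter (fun a => a + τ a = w)).card := by
          refine sum_le_sum fun w hw => (min_le_right _ _).trans ?_
          rw [mem_filter] at hw
          rw [rep_eq_card_filter_left]
          refine card_le_card fun a ha => ?_
          rw [mem_filter] at ha ⊢
          have hτa : τ a = w - a := by
            by_contra hne
            apply hw.2
            rw [hR, mem_image]
            exact ⟨(a, w - a), mem_filter.2 ⟨mem_product.2 ⟨ha.1, ha.2⟩, fun h => hne h.symm⟩, by simp⟩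
          refine ⟨mem_filter.2 ⟨ha.1, by rw [hτa]; exact ha.2⟩, by rw [hτa]; abel⟩
      _ = ((D.filter (fun a => a + τ a ∈ (A + B).filter (fun w => w ∉ R)))).card := by
          rw [card_eq_sum_card_fiberwise (f := fun a => a + τ a) (t := (A + B).filter (fun w => w ∉ R))
            (s := D.filter (fun a => a + τ a ∈ (A + B).filter (fun w => w ∉ R)))
            (fun a ha => (mem_filter.1 (mem_coe.1 ha)).2)]
          refine sum_congr rfl fun w hw => ?_
          congr 1
          ext a
          simp only [mem_filter]
          constructor
          · rintro ⟨hD', rfl⟩; exact ⟨⟨hD', mem_filter.1 hw⟩, rfl⟩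
          · rintro ⟨⟨hD', -⟩, h⟩; exact ⟨hD', h⟩
      _ ≤ D.card := card_le_card (filter_subset _ _)
  omega

/-- Pigeonhole: `|A| + |B| ≥ |G| + 1` forces `A + B = G`. [cite: GrynkiewiczWang2026, Prop 1.1] -/
theorem add_eq_univ_of_card [Fintype G] (h : Fintype.card G + 1 ≤ A.card + B.card) : A + B = univ := by
  refine eq_univ_of_forall fun g => ?_
  by_contra hg
  have hdisj : Disjoint (A.image (fun a => g - a)) B := by
    rw [disjoint_left]
    intro x hx hxB
    obtain ⟨a, ha, rfl⟩ := mem_image.1 hx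
    exact hg (by rw [show g = a + (g - a) by abel]; exact add_mem_add ha hxB)
  have hinj : Set.InjOn (fun a => g - a) ↑A := fun a _ b _ (e : g - a = g - b) => by simpa using e
  have := card_le_univ (A.image (fun a => g - a) ∪ B)
  rw [card_union_of_disjoint hdisj, card_image_of_injOn hinj] at this
  omega

/-- Case II of the source: if `(A′, B′)` is a structure for `(A, B)` at level `t` (`ℓ ≤ t − 1`, every element of
`A′ + B′` has `≥ t` representations, `A′ + B′ = A +_t B`), `τ` is injective on `A` and `A + B = G`, then
`t (|G| − |A +^τ B|) ≤ (t − 1)·ℓ′ + (|τ| − ℓ′)` where `ℓ′ ≤ ℓ` counts the pairs `(a, τ a)` leaving `A′ × B′`; in the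
form `t|G| + ℓ′ ≤ t|A +^τ B| + tℓ′ + |τ|` with `ℓ′ ≤ t − 1`. [cite: GrynkiewiczWang2026, Thm 3.2] -/
theorem restricted_of_str [Fintype G] {A' B' : Finset G} (hS : Str t A B A' B') (hτ : Set.InjOn τ ↑A)
    (hAB : A + B = univ) :
    ∃ l' : ℕ, l' + 1 ≤ t ∧
      t * Fintype.card G + l' ≤
        t * (((A ×ˢ B).filter (fun p => p.2 ≠ τ p.1)).image (fun p => p.1 + p.2)).card + t * l' +
          (A.filter (fun a => τ a ∈ B)).card := by
  set R := ((A ×ˢ B).filter (fun p => p.2 ≠ τ p.1)).image (fun p => p.1 + p.2) with hR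
  set D := A.filter (fun a => τ a ∈ B) with hD
  -- the pairs `(a, τ a)` leaving `A' × B'`
  set Dout := D.filter (fun a => a ∉ A' ∨ τ a ∉ B') with hDout
  set Din := D.filter (fun a => a ∈ A' ∧ τ a ∈ B') with hDin
  have hDsplit : Dout.card + Din.card = D.card := by
    rw [hDout, hDin, ← card_filter_add_card_filter_not (s := D) (fun a => a ∉ A' ∨ τ a ∉ B')]
    congr 2
    exact filter_congr fun a _ => by rw [not_or, not_not, not_not]
  -- `|Dout| ≤ ℓ`: inject into `(A \ A') ⊕ (B \ B')`
  have hDout_le : Dout.card ≤ (A \ A').card + (B \ B').card := by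
    have hsub : Dout ⊆ (A \ A') ∪ (Dout.filter (fun a => a ∈ A')) := by
      intro a ha
      rw [mem_union, mem_sdiff, mem_filter]
      by_cases haA' : a ∈ A'
      · exact Or.inr ⟨ha, haA'⟩
      · exact Or.inl ⟨(mem_filter.1 (mem_filter.1 ha).1).1, haA'⟩
    have h2 : (Dout.filter (fun a => a ∈ A')).card ≤ (B \ B').card := by
      have hinj : Set.InjOn τ ↑(Dout.filter (fun a => a ∈ A')) := fun a ha b hb e =>
        hτ (mem_filter.1 (mem_filter.1 (mem_filter.1 (mem_coe.1 ha)).1).1).1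
          (mem_filter.1 (mem_filter.1 (mem_filter.1 (mem_coe.1 hb)).1).1).1 e
      rw [← card_image_of_injOn hinj]
      refine card_le_card fun b hb => ?_
      obtain ⟨a, ha, rfl⟩ := mem_image.1 hb
      rw [mem_filter] at ha
      have haD := mem_filter.1 ha.1
      rw [mem_sdiff]
      refine ⟨(mem_filter.1 haD.1).2, ?_⟩
      rcases haD.2 with h | h
      · exact absurd ha.2 h
      · exact h
    exact (card_le_card hsub).trans ((card_union_le _ _).trans (by omega))
  refine ⟨Dout.card, by have := hS.2.2.1; omega, ?_⟩
  -- the complement of `R`: each `w ∉ R` has all representations `(a, τ a)`, `a ∈ D`, `a + τ a = w`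
  have hfib : ∀ w, w ∉ R → ∀ a ∈ A, w - a ∈ B → τ a = w - a := by
    intro w hw a ha hb
    by_contra hne
    apply hw
    rw [hR, mem_image]
    exact ⟨(a, w - a), mem_filter.2 ⟨mem_product.2 ⟨ha, hb⟩, fun h => hne h.symm⟩, by simp⟩
  -- split `Rᶜ` into `W₁` (some representing `a ∈ Dout`) and `W₂` (all representing `a ∈ Din`)
  set W := (univ : Finset G).filter (fun w => w ∉ R) with hW
  set W₁ := W.filter (fun w => ∃ a ∈ Dout, a + τ a = w) with hW₁
  set W₂ := W.filter (fun w => ¬ ∃ a ∈ Dout, a + τ a = w) with hW₂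
  have hWsplit : W₁.card + W₂.card = W.card := card_filter_add_card_filter_not _
  have hWR : W.card + R.card = Fintype.card G := by
    have hWc : W = Rᶜ := by ext w; simp [hW]
    rw [hWc, Finset.card_compl]
    have := card_le_univ R
    omega
  -- `|W₁| ≤ |Dout|`
  have hW₁ : W₁.card ≤ Dout.card := by
    have : W₁ ⊆ Dout.image (fun a => a + τ a) := by
      intro w hw
      obtain ⟨a, ha, e⟩ := (mem_filter.1 hw).2
      exact mem_image.2 ⟨a, ha, e⟩
    exact (card_le_card this).trans card_image_le
  -- `t |W₂| ≤ |Din|`: each `w ∈ W₂` has `≥ t` representations, all `(a, τ a)` with `a ∈ Din`, fibres disjoint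
  have hW₂ : t * W₂.card ≤ Din.card := by
    have hfibre : ∀ w ∈ W₂, t ≤ (Din.filter (fun a => a + τ a = w)).card := by
      intro w hw
      rw [hW₂, mem_filter, hW, mem_filter] at hw
      obtain ⟨⟨-, hwR⟩, hno⟩ := hw
      -- `w ∈ A + B = G`; pick a representation; it is `(a, τ a)` with `a ∈ Din`, so `w ∈ A' + B'`
      have hwAB : w ∈ A + B := by rw [hAB]; exact mem_univ w
      obtain ⟨a, ha, b, hb, rfl⟩ := mem_add.1 hwAB
      have hτa : τ a = b := by have := hfib _ hwR a ha (by simpa using hb); simpa using this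
      have haD : a ∈ D := mem_filter.2 ⟨ha, hτa ▸ hb⟩
      have haDin : a ∈ A' ∧ τ a ∈ B' := by
        by_contra hcon
        rw [not_and_or] at hcon
        exact hno ⟨a, mem_filter.2 ⟨haD, hcon⟩, by rw [hτa]⟩
      have hwS : a + b ∈ A' + B' := by rw [← hτa]; exact add_mem_add haDin.1 haDin.2
      have hrep := hS.2.2.2.1 _ hwS
      -- every representation in `A' × B'` is `(a', τ a')` with `a' ∈ Din`
      rw [rep_eq_card_filter_left] at hrep
      refine hrep.trans (card_le_card fun a' ha' => ?_)
      rw [mem_filter] at ha' ⊢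
      have ha'A : a' ∈ A := hS.1 ha'.1
      have hb'B : a + b - a' ∈ B := hS.2.1 ha'.2
      have hτa' : τ a' = a + b - a' := hfib _ hwR a' ha'A hb'B
      have ha'D : a' ∈ D := mem_filter.2 ⟨ha'A, hτa' ▸ hb'B⟩
      refine ⟨mem_filter.2 ⟨ha'D, ?_⟩, by rw [hτa']; abel⟩
      by_contra hcon
      rw [not_and_or] at hcon
      exact hno ⟨a', mem_filter.2 ⟨ha'D, hcon⟩, by rw [hτa']; abel⟩
    have hdisj : ∀ w ∈ W₂, ∀ w' ∈ W₂, w ≠ w' →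
        Disjoint (Din.filter (fun a => a + τ a = w)) (Din.filter (fun a => a + τ a = w')) := by
      intro w _ w' _ hne
      rw [disjoint_left]
      intro a ha ha'
      exact hne ((mem_filter.1 ha).2.symm.trans (mem_filter.1 ha').2)
    calc t * W₂.card = ∑ w ∈ W₂, t := by rw [sum_const, smul_eq_mul, mul_comm]
      _ ≤ ∑ w ∈ W₂, (Din.filter (fun a => a + τ a = w)).card := sum_le_sum hfibre
      _ = (W₂.biUnion (fun w => Din.filter (fun a => a + τ a = w))).card := (card_biUnion hdisj).symm
      _ ≤ Din.card := card_le_card (biUnion_subset.2 fun w _ => filter_subset _ _)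
  -- assemble: `t |G| = t|R| + t|W₁| + t|W₂| ≤ t|R| + t|Dout| + |Din|`
  have e1 : t * Fintype.card G = t * R.card + t * W₁.card + t * W₂.card := by
    rw [← hWR, ← hWsplit]; ring
  have h3 : t * W₁.card ≤ t * Dout.card := Nat.mul_le_mul_left t hW₁
  omega

/-- The integer core of Theorem 3.2: for `|A| + |B| ≥ |G| + 1`, `τ` injective on `A`, and every `t` with
`2 ≤ t ≤ min(|A|,|B|)`: `3t|G| + 5t ≤ 3t|A +^τ B| + 4t² + 3 min(|A|,|B|)` (i.e. the printed
`|A +^τ B| ≥ |G| − (4/3)t − M/t + 5/3`). [cite: GrynkiewiczWang2026, Thm 3.2] -/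
theorem key_ineq [Fintype G] (hτ : Set.InjOn τ ↑A) (hAB : Fintype.card G + 1 ≤ A.card + B.card)
    (ht2 : 2 ≤ t) (htA : t ≤ A.card) (htB : t ≤ B.card) :
    3 * t * Fintype.card G + 5 * t ≤
      3 * t * (((A ×ˢ B).filter (fun p => p.2 ≠ τ p.1)).image (fun p => p.1 + p.2)).card + 4 * t * t +
        3 * min A.card B.card := by
  set R := ((A ×ˢ B).filter (fun p => p.2 ≠ τ p.1)).image (fun p => p.1 + p.2) with hR
  set D := A.filter (fun a => τ a ∈ B) with hD
  -- `|τ| ≤ min(|A|, |B|)`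
  have hDA : D.card ≤ A.card := card_le_card (filter_subset _ _)
  have hDB : D.card ≤ B.card := by
    have hinj : Set.InjOn τ ↑D := fun a ha b hb e =>
      hτ (mem_filter.1 (mem_coe.1 ha)).1 (mem_filter.1 (mem_coe.1 hb)).1 e
    rw [← card_image_of_injOn hinj]
    exact card_le_card fun b hb => by
      obtain ⟨a, ha, rfl⟩ := mem_image.1 hb
      exact (mem_filter.1 ha).2
  have hDM : D.card ≤ min A.card B.card := le_min hDA hDB
  obtain ⟨-, hc3, -⟩ := const_bounds ht2
  rcases goal_all ht2 A B htA htB with hP | ⟨A', B', hS⟩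
  · -- Case I
    have h1 := NS_le_mul_card_restricted_add t A B τ
    rw [← hR, ← hD] at h1
    have e3 : 3 * t * Fintype.card G = 3 * (t * Fintype.card G) := by ring
    have e4 : 3 * t * R.card = 3 * (t * R.card) := by ring
    have hG : t * Fintype.card G + t ≤ t * (A.card + B.card) := by
      have := Nat.mul_le_mul_left t hAB; linarith
    have h2t : 2 * t ≤ 4 * t * t := by nlinarith
    omega
  · -- Case II
    obtain ⟨l', hl't, hkey⟩ := restricted_of_str hS hτ (add_eq_univ_of_card hAB)
    rw [← hR, ← hD] at hkey
    -- `t|G| ≤ t|R| + (t-1) l' + |D| ≤ t|R| + (t-1)² + M`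
    have hl : (t - 1) * l' ≤ (t - 1) * (t - 1) := Nat.mul_le_mul_left _ (by omega)
    obtain ⟨s, rfl⟩ : ∃ s, t = s + 2 := ⟨t - 2, by omega⟩
    have e0 : s + 2 - 1 = s + 1 := by omega
    rw [e0] at hl
    nlinarith [hkey, hl, hDM]

end Counting

/-! ### Theorem 3.2 -/

section Main

/-- **[GrynkiewiczWang2026] Theorem 3.2** (as printed): for a finite abelian group `G`, subsets `A, B ⊆ G` with
`|A| + |B| ≥ |G| + 1`, and a map `τ` injective on `A`,
`|A +^τ B| ≥ |G| + (1 − 4√(3·min{|A|,|B|}))/3`, where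
`A +^τ B = {a + b : a ∈ A, b ∈ B, b ≠ τ(a)}`.  (From `key_ineq` at `t = ⌈√(3M)/2⌉ ∈ [2, M]` when
`M = min{|A|,|B|} ≥ 2`; the case `M = 1` directly.) [cite: GrynkiewiczWang2026, Thm 3.2] -/
theorem grynkiewiczWang2026_thm_3_2 [Fintype G] (A B : Finset G) (τ : G → G) (hτ : Set.InjOn τ ↑A)
    (hAB : Fintype.card G + 1 ≤ A.card + B.card) :
    (Fintype.card G : ℝ) + (1 - 4 * Real.sqrt (3 * (min A.card B.card : ℕ))) / 3 ≤
      ((((A ×ˢ B).filter (fun p => p.2 ≠ τ p.1)).image (fun p => p.1 + p.2)).card : ℝ) := by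
  set R := ((A ×ˢ B).filter (fun p => p.2 ≠ τ p.1)).image (fun p => p.1 + p.2) with hR
  set M := min A.card B.card with hM
  have hG : (0 : ℝ) ≤ Fintype.card G := Nat.cast_nonneg _
  have hsq3 : (1 : ℝ) < Real.sqrt 3 := by
    rw [show (1 : ℝ) = Real.sqrt 1 by simp]
    exact Real.sqrt_lt_sqrt (by norm_num) (by norm_num)
  -- `M ≥ 1`
  have hM1 : 1 ≤ M := by
    rw [hM, le_min_iff]
    have := card_le_univ A; have := card_le_univ B
    constructor <;> omega
  by_cases hM2 : M < 2
  · -- `M = 1`: the larger set is all of `G` and at most one pair `(a, τ a)` is lost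
    have hM1' : M = 1 := by omega
    have hRG : Fintype.card G ≤ R.card + 1 := by
      rcases Nat.le_total A.card B.card with hle | hle
      · -- `|A| = 1`, `B = univ`
        have hA1 : A.card = 1 := by rw [hM, min_eq_left hle] at hM1'; exact hM1'
        obtain ⟨a, rfl⟩ := card_eq_one.1 hA1
        have hBU : B.card = Fintype.card G := le_antisymm (card_le_univ B) (by simp at hAB; omega)
        have hsub : (B.erase (τ a)).image (fun b => a + b) ⊆ R := by
          intro w hw
          obtain ⟨b, hb, rfl⟩ := mem_image.1 hw
          rw [mem_erase] at hb
          exact mem_image.2 ⟨(a, b), mem_filter.2 ⟨mem_product.2 ⟨mem_singleton_self a, hb.2⟩, hb.1⟩, rfl⟩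
        have := card_le_card hsub
        rw [card_image_of_injective _ (add_right_injective a)] at this
        have := card_erase_le (s := B) (a := τ a)
        have h3 : B.card ≤ (B.erase (τ a)).card + 1 := by
          rw [card_erase_eq_ite]; split_ifs <;> omega
        omega
      · -- `|B| = 1`, `A = univ`
        have hB1 : B.card = 1 := by rw [hM, min_eq_right hle] at hM1'; exact hM1'
        obtain ⟨b, rfl⟩ := card_eq_one.1 hB1
        have hAU : A.card = Fintype.card G := le_antisymm (card_le_univ A) (by simp at hAB; omega)
        have hsub : (A.filter (fun a => τ a ≠ b)).image (fun a => a + b) ⊆ R := by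
          intro w hw
          obtain ⟨a, ha, rfl⟩ := mem_image.1 hw
          rw [mem_filter] at ha
          exact mem_image.2 ⟨(a, b), mem_filter.2 ⟨mem_product.2 ⟨ha.1, mem_singleton_self b⟩, ha.2.symm⟩, rfl⟩
        have h1 := card_le_card hsub
        rw [card_image_of_injective _ (add_left_injective b)] at h1
        -- at most one `a ∈ A` has `τ a = b`
        have h2 : (A.filter (fun a => ¬ τ a ≠ b)).card ≤ 1 := by
          rw [card_le_one]
          intro x hx y hy
          rw [mem_filter, not_not] at hx hy
          exact hτ hx.1 hy.1 (hx.2.trans hy.2.symm)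
        have h3 := card_filter_add_card_filter_not (s := A) (fun a => τ a ≠ b)
        omega
    have hRG' : (Fintype.card G : ℝ) ≤ R.card + 1 := by exact_mod_cast hRG
    have hs : Real.sqrt (3 * (M : ℕ)) = Real.sqrt 3 := by rw [hM1']; norm_num
    rw [hs]
    nlinarith [hsq3, hRG']
  · -- `M ≥ 2`: `t = ⌈√(3M)/2⌉`
    rw [not_lt] at hM2
    have hMR : (2 : ℝ) ≤ M := by exact_mod_cast hM2
    set s := Real.sqrt (3 * (M : ℕ)) with hs
    have hs0 : 0 ≤ s := Real.sqrt_nonneg _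
    have hss : s * s = 3 * M := by
      rw [hs]; exact Real.mul_self_sqrt (by positivity)
    have hs2 : 2 < s := by nlinarith [hss, hMR, hs0]
    set t := ⌈s / 2⌉₊ with ht
    have ht_ge : s / 2 ≤ t := Nat.le_ceil _
    have ht_lt : (t : ℝ) < s / 2 + 1 := Nat.ceil_lt_add_one (by positivity)
    have ht2 : 2 ≤ t := by
      have : (1 : ℝ) < t := by linarith
      have : 1 < t := by exact_mod_cast this
      omega
    have htM : t ≤ M := by
      rw [ht]
      refine Nat.ceil_le.2 ?_
      -- `s/2 ≤ M` since `s² = 3M ≤ 4M²`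
      nlinarith [hss, hMR, hs0]
    have htA : t ≤ A.card := htM.trans (min_le_left _ _)
    have htB : t ≤ B.card := htM.trans (min_le_right _ _)
    have hkey := key_ineq hτ hAB ht2 htA htB
    rw [← hR, ← hM] at hkey
    have hkey' : (3 : ℝ) * t * Fintype.card G + 5 * t ≤ 3 * t * R.card + 4 * t * t + 3 * M := by
      exact_mod_cast hkey
    have ht0 : (0 : ℝ) < t := by exact_mod_cast (show 0 < t by omega)
    -- divide by `3t`: `R ≥ |G| + 5/3 − (4/3) t − M / t`, then `t ≤ s/2 + 1`, `M/t ≤ M/(s/2) = (2/3) s`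
    have hMt : (M : ℝ) * 3 ≤ 2 * s * t := by
      -- `3M = s² ≤ s · 2t`
      nlinarith [hss, ht_ge, hs0]
    have hmain : (3 : ℝ) * t * (Fintype.card G + (1 - 4 * s) / 3) ≤ 3 * t * R.card := by
      nlinarith [hkey', hMt, ht_lt, ht0, hs0]
    exact le_of_mul_le_mul_left hmain (by positivity)

end Main

end GrynkiewiczWang

end Literature.Combinatorics.Additive
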